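import Summits.BirchSwinnertonDyer.BirchSwinnertonDyer.Theorems.EisensteinPrimesKatzLineDescentODE
import Summits.BirchSwinnertonDyer.BirchSwinnertonDyer.Theorems.EisensteinPrimesKatzLineDescentPeeling
import Summits.BirchSwinnertonDyer.BirchSwinnertonDyer.Theorems.EisensteinPrimesKatzLineDescentWronskian
import Summits.BirchSwinnertonDyer.BirchSwinnertonDyer.Theorems.EisensteinPrimesKatzLineDescentBinomialBound
import HarnessLib

/-!
# Different-period rigidity, STRUCTURAL FORM (AN-F₂, route (RIG), alternative ODE road): two bounded
# series with `Q(u^k − 1) = d^k·L(u^k − 1)` for all `k ≥ 1` differ by a unit constant and a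
# `(1+T)^{ℤ_p}`-twist — `L = c·(1+T)^b·Q`, `b ∈ ℤ_p`, `‖c‖ = 1`
# (helper file for crux 2 `GoodLatticeBDPValue`, stmt-BirchSwinnertonDyer-19032, line `halves`; the λ-descent stub
# `stub_katzLineDescentQ` is CLOSED (p638329) through w4 gen 2's index rigidity p636909/p637380 — this file is the
# structural strengthening of that index statement, by a different proof; seat `bsd-line-x1-p1-w3` gen 2)

THE ODE ROAD, ASSEMBLED. For `Q, L ∈ ℂ_p⟦T⟧` with coefficients of norm `≤ 1`, `Q` with first unit
coefficient at `m`, a principal unit `u` (`‖u − 1‖ < 1`, `u^{p^j} ≠ 1`) and `d ∈ ℂ_p` with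
`Q(u^k − 1) = d^k · L(u^k − 1)` for every `k ≥ 1` (two CGLS-type frames of one `θ_K` at different
period pairs, read along the powers of one interpolation character):
(1) `…Relation`/`…ODE`: `‖d‖ = 1` and `(1+T)(QL′ − Q′L) + aQL = 0`; (2) `…Wronskian`: `L = c·(1+T)^{−a}·Q`;
(3) `c ≠ 0` (else `Q` would vanish at every node); (4) Weierstrass preparation `Q = P·U` over `𝓞_{ℂ_p}`
(`Dwork.exists_eq_polynomial_mul_of_norm_le_one`) and root peeling (`…Peeling`): `c·(1+T)^{−a}·P = L·V`
is bounded, hence `(1+T)^{−a}` is bounded; (5) `…BinomialBound`: `−a = b ∈ ℤ_p`, so `(1+T)^{−a}` is the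
image of `PowerSeries.binomialSeries ℤ_p b ∈ ℤ_p⟦T⟧` — integral coefficients, constant term `1`; (6) norms of values at
a node where `Q ≠ 0` give `‖c‖ = 1`.

* `exists_eq_C_mul_binomialSeries_map_mul_of_relation` — **`L = c·(1+T)^b·Q`** with `b ∈ ℤ_p`,
  `‖c‖ = 1` (so a ♭-frame and an `R₀`-frame of the same `θ_K` differ by a `(1+T)^{ℤ_p}`-twist; in
  particular the ♭-frame is `R₀`-valued as soon as one `R₀`-frame exists);
* `firstUnit_of_relation` — consequently `L` has its first unit coefficient at the same index `m`
  (the index statement of record is w4 gen 2's `KatzLineRigidity.firstUnitCoeffAt_eq_of_powMap_identity`,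
  p636909, under the power-map identity; here it drops out of the structural form under the value relation).

Pure `p`-adic analysis; no fact, no definition, no `sorry`; nothing about BSD.
References: Washington 1997 §5.1, §7.1 Prop. 7.2, §7.2 Thm. 7.3; Cassels 1986 Ch. 4 Thm. 4.1, Ch. 6 §5;
Koblitz 1984 Ch. IV §4 Thm. 14; de Shalit 1987 II.4.12 Remark (iv).
-/

-- the summit namespace `Summit.BirchSwinnertonDyer.BirchSwinnertonDyer` repeats the problem name by design (D-0017)
set_option linter.dupNamespace false
set_option autoImplicit false

noncomputable section

open scoped Classical Topology

open Filter Finset PowerSeries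
open Summit.BirchSwinnertonDyer.Rank1Residual.X11b
open Literature.NumberTheory.LFunctions

namespace Summit.BirchSwinnertonDyer.BirchSwinnertonDyer.Theorems.KatzLineDescent

variable {p : ℕ} [Fact p.Prime]

/-- The value at a point of the open disc of a series with coefficients of norm `≤ 1` and constant
term `1` has norm `1`. [cite: Washington1997, §7.1] -/
theorem norm_tsum_eq_one_of_coeff_zero_eq_one {F : PowerSeries ℂ_[p]} (hF : ∀ n, ‖coeff n F‖ ≤ 1)
    (h0 : coeff 0 F = 1) {x : ℂ_[p]} (hx : ‖x‖ < 1) : ‖∑' n, coeff n F * x ^ n‖ = 1 := by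
  have hs := summable_mul_pow hF hx
  rw [hs.tsum_eq_zero_add, h0, pow_zero, mul_one]
  apply R1.norm_eq_one_of_norm_sub_one_lt
  rw [add_sub_cancel_left]
  have hs' : Summable (fun n : ℕ ↦ coeff (n + 1) F * x ^ (n + 1)) := by
    have key := hs; rw [← summable_nat_add_iff 1] at key; exact key
  calc ‖∑' n, coeff (n + 1) F * x ^ (n + 1)‖
      ≤ ‖x‖ := by
        refine IsUltrametricDist.norm_tsum_le_of_forall_le_of_nonneg (norm_nonneg x) fun n ↦ ?_
        rw [norm_mul, norm_pow, pow_succ]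
        calc ‖coeff (n + 1) F‖ * (‖x‖ ^ n * ‖x‖) ≤ 1 * (1 * ‖x‖) := by
              gcongr
              · exact hF _
              · exact pow_le_one₀ (norm_nonneg _) hx.le
          _ = ‖x‖ := by ring
    _ < 1 := hx

/-- **DIFFERENT-PERIOD RIGIDITY, STRUCTURAL FORM.** Let `Q, L ∈ ℂ_p⟦T⟧` have coefficients of norm
`≤ 1`, `Q` with first unit coefficient at `m`; let `u` be a principal unit with `u^{p^j} ≠ 1` for all
`j`, and `d ∈ ℂ_p` with `Q(u^k − 1) = d^k · L(u^k − 1)` for every `k ≥ 1`. Then there are `c ∈ ℂ_p`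
with `‖c‖ = 1` and `b ∈ ℤ_p` with `L = c · (1+T)^b · Q`, `(1+T)^b = Σ C(b,n)T^n ∈ ℤ_p⟦T⟧` read in
`ℂ_p⟦T⟧`. [cite: Washington1997, §7.1 Prop. 7.2, §7.2 Thm. 7.3] [cite: Cassels1986, Ch. 4 Thm. 4.1, Ch. 6 §5]
[cite: Koblitz1984, Ch. IV §4 Thm. 14] -/
theorem exists_eq_C_mul_binomialSeries_map_mul_of_relation {Q L : PowerSeries ℂ_[p]}
    (hQ1 : ∀ n, ‖coeff n Q‖ ≤ 1) (hL1 : ∀ n, ‖coeff n L‖ ≤ 1) {m : ℕ}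
    (hm : ‖coeff m Q‖ = 1 ∧ ∀ i < m, ‖coeff i Q‖ < 1) {u d : ℂ_[p]} (hu : ‖u - 1‖ < 1)
    (hu' : ∀ j : ℕ, u ^ p ^ j ≠ 1)
    (hrel : ∀ k : ℕ, 1 ≤ k →
      ∑' n, coeff n Q * (u ^ k - 1) ^ n = d ^ k * ∑' n, coeff n L * (u ^ k - 1) ^ n) :
    ∃ (c : ℂ_[p]) (b : ℤ_[p]), ‖c‖ = 1 ∧
      L = C c * (PowerSeries.binomialSeries ℤ_[p] b).map ((algebraMap ℚ_[p] ℂ_[p]).comp PadicInt.Coe.ringHom) * Q := by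
  have hQ0 : Q ≠ 0 := by
    intro h; rw [h, map_zero, norm_zero] at hm; exact zero_ne_one hm.1
  -- (1) the ODE and `‖d‖ = 1`
  obtain ⟨hd1, a, hODE⟩ := exists_ode_of_relation hQ1 hL1 hQ0 hu hu' hrel
  -- (2) `L = c (1+T)^{-a} Q`
  obtain ⟨c, hc⟩ := exists_eq_C_mul_binomialSeries_mul_of_ode a hQ0 hODE
  -- a node where `Q ≠ 0`
  obtain ⟨k₀, hk₀, hQk₀⟩ := exists_tsum_ne_zero hQ1 hQ0 hu hu'
  have hx₀ : ‖u ^ k₀ - 1‖ < 1 := (R1.norm_pow_sub_one_le hu k₀).trans_lt hu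
  -- (3) `c ≠ 0`
  have hc0 : c ≠ 0 := by
    intro h0
    apply hQk₀
    rw [hrel k₀ hk₀, hc, h0, map_zero, zero_mul, zero_mul]
    simp
  -- (4) Weierstrass preparation of `Q` and peeling
  obtain ⟨P, U, V, hP0, hUV, hQPU, hU1, hV1⟩ := Dwork.exists_eq_polynomial_mul_of_norm_le_one hQ1 hm.1 hm.2
  set Ψ := C c * PowerSeries.binomialSeries ℂ_[p] (-a) with hΨ
  have hΨode : (1 + X) * d⁄dX ℂ_[p] Ψ = C (-a) * Ψ := by
    rw [hΨ, Derivation.leibniz, derivative_C, smul_zero, add_zero, smul_eq_mul, ← mul_assoc,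
      mul_comm (1 + X), mul_assoc, one_add_X_mul_derivative_binomialSeries]
    ring
  have hΨP : Ψ * (P : PowerSeries ℂ_[p]) = L * V := by
    rw [hc, hQPU, hΨ]
    calc C c * PowerSeries.binomialSeries ℂ_[p] (-a) * (P : PowerSeries ℂ_[p])
        = C c * PowerSeries.binomialSeries ℂ_[p] (-a) * (P : PowerSeries ℂ_[p]) * (U * V) := by rw [hUV, mul_one]
      _ = C c * PowerSeries.binomialSeries ℂ_[p] (-a) * ((P : PowerSeries ℂ_[p]) * U) * V := by ring
  have hΨPb : ∀ n, ‖coeff n (Ψ * (P : PowerSeries ℂ_[p]))‖ ≤ 1 * 1 := by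
    rw [hΨP]; exact norm_coeff_mul_le hL1 hV1
  obtain ⟨B', hB'⟩ := exists_norm_coeff_le_of_ode_of_mul_polynomial hΨode P hP0 ⟨1 * 1, hΨPb⟩
  -- (5) `(1+T)^{-a}` bounded, hence `-a ∈ ℤ_p`
  have hBbd : ∀ n, ‖coeff n (PowerSeries.binomialSeries ℂ_[p] (-a))‖ ≤ ‖c⁻¹‖ * B' := by
    intro n
    have : PowerSeries.binomialSeries ℂ_[p] (-a) = C c⁻¹ * Ψ := by
      rw [hΨ, ← mul_assoc, ← map_mul, inv_mul_cancel₀ hc0, map_one, one_mul]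
    rw [this]
    exact norm_coeff_C_mul_le hB' _ n
  obtain ⟨b, hb⟩ := (bddAbove_norm_coeff_binomialSeries_iff (-a)).mp ⟨_, hBbd⟩
  set φ : ℤ_[p] →+* ℂ_[p] := (algebraMap ℚ_[p] ℂ_[p]).comp PadicInt.Coe.ringHom with hφ
  have hφb : φ b = -a := by rw [hφ, ← coe_padicInt_eq_ringHom, hb]
  have hBmap : PowerSeries.binomialSeries ℂ_[p] (-a) = (PowerSeries.binomialSeries ℤ_[p] b).map φ := by
    ext n
    rw [PowerSeries.binomialSeries_coeff, coeff_map, PowerSeries.binomialSeries_coeff, smul_eq_mul, mul_one, smul_eq_mul,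
      mul_one, ← hφb, Ring.map_choose]
  -- (6) `L = c · (1+T)^b · Q`; `‖c‖ = 1` from the values at a node where `Q ≠ 0`
  have hLeq : L = C c * (PowerSeries.binomialSeries ℤ_[p] b).map φ * Q := by rw [hc, hΨ, hBmap]
  refine ⟨c, b, ?_, hLeq⟩
  -- coefficient bounds for the twist
  have hT1 : ∀ n, ‖coeff n ((PowerSeries.binomialSeries ℤ_[p] b).map φ)‖ ≤ 1 := by
    intro n
    rw [coeff_map, PowerSeries.binomialSeries_coeff, smul_eq_mul, mul_one, hφ, ← coe_padicInt_eq_ringHom,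
      norm_coe_padicInt]
    exact PadicInt.norm_le_one _
  have hT0 : coeff 0 ((PowerSeries.binomialSeries ℤ_[p] b).map φ) = 1 := by
    rw [coeff_map, PowerSeries.binomialSeries_coeff, Ring.choose_zero_right, one_smul, map_one]
  -- values at `x₀ = u^{k₀} − 1`
  set x₀ := u ^ k₀ - 1 with hx₀def
  set β := ∑' n, coeff n ((PowerSeries.binomialSeries ℤ_[p] b).map φ) * x₀ ^ n with hβ
  set Q₀ := ∑' n, coeff n Q * x₀ ^ n with hQ₀
  set L₀ := ∑' n, coeff n L * x₀ ^ n with hL₀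
  have hβ1 : ‖β‖ = 1 := norm_tsum_eq_one_of_coeff_zero_eq_one hT1 hT0 hx₀
  have hCT : ∀ n, ‖coeff n (C c * (PowerSeries.binomialSeries ℤ_[p] b).map φ)‖ ≤ ‖c‖ * 1 :=
    norm_coeff_C_mul_le hT1 c
  have hvCT : (∑' n, coeff n (C c * (PowerSeries.binomialSeries ℤ_[p] b).map φ) * x₀ ^ n) = c * β :=
    (hasSum_coeff_C_mul hT1 hx₀ c).tsum_eq
  have hvL : HasSum (fun n ↦ coeff n L * x₀ ^ n) (c * β * Q₀) := by
    have h := hasSum_coeff_mul hCT hQ1 hx₀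
    rw [hvCT] at h
    rw [hLeq]
    exact h
  have hL₀eq : L₀ = c * β * Q₀ := (hasSum_coeff hL1 hx₀).unique hvL
  have hrel₀ : Q₀ = d ^ k₀ * L₀ := hrel k₀ hk₀
  have hQ₀0 : Q₀ ≠ 0 := hQk₀
  have hnorm : ‖Q₀‖ = ‖c‖ * ‖Q₀‖ := by
    conv_lhs => rw [hrel₀, hL₀eq]
    rw [norm_mul, norm_pow, hd1, one_pow, one_mul, norm_mul, norm_mul, hβ1, mul_one]
  have hQ₀pos : 0 < ‖Q₀‖ := norm_pos_iff.mpr hQ₀0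
  field_simp at hnorm
  linarith

/-- **Corollary: the first-unit index is preserved** — under the hypotheses of
`exists_eq_C_mul_binomialSeries_map_mul_of_relation`, `L` has its first unit coefficient at the same
index `m` as `Q` (`L = c·(1+T)^b·Q` with `‖c‖ = 1` and `(1+T)^b` integral with constant term `1`;
ultrametric dominant term). The index statement of record for AN-F₂ is w4 gen 2's
`KatzLineRigidity.firstUnitCoeffAt_eq_of_powMap_identity` (power-map hypothesis); this is the same
conclusion under the value relation, read off the structural form.
[cite: Washington1997, §7.1 Prop. 7.2] -/
theorem firstUnit_of_relation {Q L : PowerSeries ℂ_[p]}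
    (hQ1 : ∀ n, ‖coeff n Q‖ ≤ 1) (hL1 : ∀ n, ‖coeff n L‖ ≤ 1) {m : ℕ}
    (hm : ‖coeff m Q‖ = 1 ∧ ∀ i < m, ‖coeff i Q‖ < 1) {u d : ℂ_[p]} (hu : ‖u - 1‖ < 1)
    (hu' : ∀ j : ℕ, u ^ p ^ j ≠ 1)
    (hrel : ∀ k : ℕ, 1 ≤ k →
      ∑' n, coeff n Q * (u ^ k - 1) ^ n = d ^ k * ∑' n, coeff n L * (u ^ k - 1) ^ n) :
    ‖coeff m L‖ = 1 ∧ ∀ i < m, ‖coeff i L‖ < 1 := by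
  obtain ⟨c, b, hc1, hLeq⟩ := exists_eq_C_mul_binomialSeries_map_mul_of_relation hQ1 hL1 hm hu hu' hrel
  set Tw := (PowerSeries.binomialSeries ℤ_[p] b).map ((algebraMap ℚ_[p] ℂ_[p]).comp PadicInt.Coe.ringHom) with hTw
  have hT1 : ∀ n, ‖coeff n Tw‖ ≤ 1 := by
    intro n
    rw [hTw, coeff_map, PowerSeries.binomialSeries_coeff, smul_eq_mul, mul_one, ← coe_padicInt_eq_ringHom,
      norm_coe_padicInt]
    exact PadicInt.norm_le_one _
  have hT0 : coeff 0 Tw = 1 := by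
    rw [hTw, coeff_map, PowerSeries.binomialSeries_coeff, Ring.choose_zero_right, one_smul, map_one]
  -- coefficients of `Tw * Q` below `m` are small, at `m` a unit
  have hcoeff : ∀ n, coeff n L = c * ∑ ij ∈ HasAntidiagonal.antidiagonal n, coeff ij.1 Tw * coeff ij.2 Q := by
    intro n; rw [hLeq, mul_assoc, coeff_C_mul, coeff_mul]
  have hsmall : ∀ n, ∀ ij ∈ HasAntidiagonal.antidiagonal n, ij ≠ (0, n) → n ≤ m →
      ‖coeff ij.1 Tw * coeff ij.2 Q‖ < 1 := by
    intro n ij hij hne hn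
    rw [HasAntidiagonal.mem_antidiagonal] at hij
    have hj : ij.2 < m := by
      rcases Nat.lt_or_ge ij.2 n with h | h
      · omega
      · exfalso; apply hne
        have h2 : ij.2 = n := by omega
        have h1 : ij.1 = 0 := by omega
        exact Prod.ext h1 h2
    rw [norm_mul]
    calc ‖coeff ij.1 Tw‖ * ‖coeff ij.2 Q‖ ≤ 1 * ‖coeff ij.2 Q‖ :=
          mul_le_mul_of_nonneg_right (hT1 _) (norm_nonneg _)
      _ < 1 := by rw [one_mul]; exact hm.2 _ hj
  refine ⟨?_, fun i hi ↦ ?_⟩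
  · -- the term `(0, m)` dominates
    rw [hcoeff, norm_mul, hc1, one_mul]
    have hmem : ((0, m) : ℕ × ℕ) ∈ HasAntidiagonal.antidiagonal m := by
      rw [HasAntidiagonal.mem_antidiagonal, zero_add]
    rw [← Finset.add_sum_erase _ _ hmem, hT0, one_mul]
    have hrest : ‖∑ ij ∈ (HasAntidiagonal.antidiagonal m).erase (0, m), coeff ij.1 Tw * coeff ij.2 Q‖ < 1 := by
      rcases Finset.eq_empty_or_nonempty ((HasAntidiagonal.antidiagonal m).erase (0, m)) with h | h
      · rw [h, Finset.sum_empty, norm_zero]; exact one_pos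
      · refine (h.norm_sum_le_sup'_norm _).trans_lt ?_
        rw [Finset.sup'_lt_iff]
        intro ij hij
        rw [Finset.mem_erase] at hij
        exact hsmall m ij hij.2 hij.1 le_rfl
    rw [IsUltrametricDist.norm_add_eq_max_of_norm_ne_norm, hm.1]
    · exact max_eq_left hrest.le
    · rw [hm.1]; exact hrest.ne'
  · rw [hcoeff, norm_mul, hc1, one_mul]
    rcases Finset.eq_empty_or_nonempty (HasAntidiagonal.antidiagonal i) with h | h
    · rw [h, Finset.sum_empty, norm_zero]; exact one_pos
    · refine (h.norm_sum_le_sup'_norm _).trans_lt ?_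
      rw [Finset.sup'_lt_iff]
      intro ij hij
      by_cases hne : ij = (0, i)
      · rw [hne, norm_mul, hT0, norm_one, one_mul]; exact hm.2 i hi
      · exact hsmall i ij hij hne hi.le

end Summit.BirchSwinnertonDyer.BirchSwinnertonDyer.Theorems.KatzLineDescent

end
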